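import Literature.NumberTheory.QuadraticFields.ReducedQuadraticIrrationalsModules
import Literature.NumberTheory.QuadraticFields.InfrastructureLattice
import HarnessLib

/-!
# Conjugation on `ℚ(√D) ⊂ ℝ` and minima of the modules `ℤ + φℤ`

Topic `NumberTheory/QuadraticFields`; continues `ReducedQuadraticIrrationalsModules.lean`.
Theorem-and-definition file (no named facts). The elements `r + s√D` (`r, s ∈ ℚ`) of the real
quadratic field inside `ℝ` have unique coordinates when `D` is not a square, so the conjugation
`r + s√D ↦ r − s√D` is a well-defined ring homomorphism on them (Jozsa 2003, §1 eq. (2)–(3):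
"`ξ ↦ ξ̄` … well defined by the irrationality of `√d`"; Jacobson–Williams §3.1). We record it as a
function `conjOf` on `ℝ` (junk value `0` off `ℚ(√D)`), and with it Jozsa's **minima** of a module
(§6.1 Def. 3: `α > 0` in `I` with no nonzero `β ∈ I`, `|β| < α`, `|β̄| < |ᾱ|`):

* `qd D r s = r + s√D`, `qd_inj`, `conjOf`, `conjOf_qd`, `conjOf_add/neg/mul/inv/intCast`,
  `IsQD` (membership in `ℚ(√D)`) and its closure properties;
* `conjOf_val`/`conjOf_conj_eq`: `conjOf (val x) = conj x`;
* `IsMinimum M t` and **`isMinimum_one_of_isReduced`**: `1` is a minimum of `J(w) = ℤ + φℤ` for a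
  reduced `w` (Jozsa Props. 20/23; JW Thm. 5.8, second half: `|x + yφ| < 1`, `|x + yφ̄| < 1`
  force `x = y = 0`);
* `isMinimum_smul`: minima scale (Jozsa Prop. 22).

## References

* R. Jozsa, arXiv:quant-ph/0302134 (2003), §1 (2)–(3), §6.1 Def. 3, Props. 20, 22, 23. [Jozsa2003]
* M. J. Jacobson, Jr., H. C. Williams, *Solving the Pell Equation*, Springer (2009), §3.1, §5.1
  Thm. 5.8. [JacobsonWilliams2008]
-/

noncomputable section

open scoped Classical

namespace Literature.NumberTheory.QuadraticFields

namespace QuadIrr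

variable {D : ℕ}

/-! ### `ℚ(√D)` inside `ℝ` and its conjugation -/

/-- `r + s√D`. [cite: JacobsonWilliams2008, §3.1 (numbers a + b√D, a, b ∈ ℚ)] -/
def qd (D : ℕ) (r s : ℚ) : ℝ := r + s * Real.sqrt D

/-- **Unique coordinates**: `r + s√D = r' + s'√D` forces `(r, s) = (r', s')` (`√D ∉ ℚ`).
[cite: Jozsa2003, §1 (eq. (2): s + t√d = s' + t'√d iff s = s', t = t')] -/
theorem qd_inj (hD : ¬ IsSquare D) {r s r' s' : ℚ} (h : qd D r s = qd D r' s') : r = r' ∧ s = s' := by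
  unfold qd at h
  by_cases hs : s = s'
  · subst hs
    have : (r : ℝ) = r' := by linarith
    exact ⟨by exact_mod_cast this, rfl⟩
  · exfalso
    have hne : ((s - s' : ℚ) : ℝ) ≠ 0 := by
      have : s - s' ≠ 0 := sub_ne_zero.mpr hs
      exact_mod_cast this
    have : Real.sqrt D = ((r' - r : ℚ) : ℝ) / ((s - s' : ℚ) : ℝ) := by
      rw [eq_div_iff hne]; push_cast; linarith
    exact (irrational_sqrt hD).ne_rat ((r' - r) / (s - s')) (by rw [this]; push_cast; rfl)

/-- Membership in `ℚ(√D)`. [cite: JacobsonWilliams2008, §3.1] -/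
def IsQD (D : ℕ) (t : ℝ) : Prop := ∃ r s : ℚ, t = qd D r s

/-- **Conjugation** `r + s√D ↦ r − s√D` as a function on `ℝ` (junk value `0` off `ℚ(√D)`).
[cite: Jozsa2003, §1 (eq. (3), conjugation)] -/
def conjOf (D : ℕ) (t : ℝ) : ℝ :=
  if h : IsQD D t then qd D h.choose (-h.choose_spec.choose) else 0

/-- `conjOf (r + s√D) = r − s√D`. [cite: Jozsa2003, §1 (eq. (3))] -/
theorem conjOf_qd (hD : ¬ IsSquare D) (r s : ℚ) : conjOf D (qd D r s) = qd D r (-s) := by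
  have h : IsQD D (qd D r s) := ⟨r, s, rfl⟩
  unfold conjOf
  rw [dif_pos h]
  obtain ⟨h1, h2⟩ := qd_inj hD h.choose_spec.choose_spec
  congr 1
  · exact h1.symm
  · exact congrArg Neg.neg h2.symm

/-- Sums in `ℚ(√D)`. [folklore] -/
theorem qd_add (r s r' s' : ℚ) : qd D r s + qd D r' s' = qd D (r + r') (s + s') := by
  unfold qd; push_cast; ring

/-- Products in `ℚ(√D)`. [cite: JacobsonWilliams2008, §3.1 (N(αβ) = N(α)N(β), conjugate of a product)] -/
theorem qd_mul (r s r' s' : ℚ) : qd D r s * qd D r' s' = qd D (r * r' + s * s' * D) (r * s' + r' * s) := by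
  unfold qd
  have hs : Real.sqrt (D : ℝ) ^ 2 = D := sqrt_sq
  push_cast
  linear_combination (s * s' : ℝ) * hs

/-- Negation in `ℚ(√D)`. [folklore] -/
theorem qd_neg (r s : ℚ) : -qd D r s = qd D (-r) (-s) := by unfold qd; push_cast; ring

/-- Integers are in `ℚ(√D)`. [folklore] -/
theorem qd_intCast (m : ℤ) : ((m : ℝ)) = qd D m 0 := by unfold qd; push_cast; ring

/-- `ℚ(√D)` is closed under addition. [folklore] -/
theorem IsQD.add {t u : ℝ} (ht : IsQD D t) (hu : IsQD D u) : IsQD D (t + u) := by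
  obtain ⟨r, s, rfl⟩ := ht; obtain ⟨r', s', rfl⟩ := hu; exact ⟨_, _, qd_add r s r' s'⟩

/-- `ℚ(√D)` is closed under multiplication. [folklore] -/
theorem IsQD.mul {t u : ℝ} (ht : IsQD D t) (hu : IsQD D u) : IsQD D (t * u) := by
  obtain ⟨r, s, rfl⟩ := ht; obtain ⟨r', s', rfl⟩ := hu; exact ⟨_, _, qd_mul r s r' s'⟩

/-- `ℚ(√D)` is closed under negation. [folklore] -/
theorem IsQD.neg {t : ℝ} (ht : IsQD D t) : IsQD D (-t) := by
  obtain ⟨r, s, rfl⟩ := ht; exact ⟨_, _, qd_neg r s⟩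

/-- Integers are in `ℚ(√D)`. [folklore] -/
theorem IsQD.intCast (m : ℤ) : IsQD D (m : ℝ) := ⟨m, 0, qd_intCast m⟩

/-- The value `φ = (P + √D)/Q` of a quotient is in `ℚ(√D)`. [cite: JacobsonWilliams2008, §3.1] -/
theorem isQD_val (x : QuadIrr D) : IsQD D x.val :=
  ⟨x.P / x.Q, 1 / x.Q, by unfold qd val; push_cast; ring⟩

/-- `conjOf (φ) = φ̄`. [cite: JacobsonWilliams2008, §3.1 (conjugate)] -/
theorem conjOf_val (hD : ¬ IsSquare D) (x : QuadIrr D) : conjOf D x.val = x.conj := by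
  have : x.val = qd D (x.P / x.Q) (1 / x.Q) := by unfold qd val; push_cast; ring
  rw [this, conjOf_qd hD]
  unfold qd conj; push_cast; ring

/-- Conjugation is additive on `ℚ(√D)`. [cite: Jozsa2003, §1 (eq. (3))] -/
theorem conjOf_add (hD : ¬ IsSquare D) {t u : ℝ} (ht : IsQD D t) (hu : IsQD D u) :
    conjOf D (t + u) = conjOf D t + conjOf D u := by
  obtain ⟨r, s, rfl⟩ := ht; obtain ⟨r', s', rfl⟩ := hu
  rw [qd_add, conjOf_qd hD, conjOf_qd hD, conjOf_qd hD, qd_add, neg_add]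

/-- Conjugation is multiplicative on `ℚ(√D)`. [cite: Jozsa2003, §1 (eq. (3))] -/
theorem conjOf_mul (hD : ¬ IsSquare D) {t u : ℝ} (ht : IsQD D t) (hu : IsQD D u) :
    conjOf D (t * u) = conjOf D t * conjOf D u := by
  obtain ⟨r, s, rfl⟩ := ht; obtain ⟨r', s', rfl⟩ := hu
  rw [qd_mul, conjOf_qd hD, conjOf_qd hD, conjOf_qd hD, qd_mul]
  congr 1 <;> ring

/-- Conjugation fixes integers. [cite: Jozsa2003, §1 (eq. (3))] -/
theorem conjOf_intCast (hD : ¬ IsSquare D) (m : ℤ) : conjOf D (m : ℝ) = m := by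
  rw [qd_intCast (D := D) m, conjOf_qd hD, neg_zero]

/-- Conjugation of a negation. [folklore] -/
theorem conjOf_neg (hD : ¬ IsSquare D) {t : ℝ} (ht : IsQD D t) : conjOf D (-t) = -conjOf D t := by
  obtain ⟨r, s, rfl⟩ := ht
  rw [qd_neg, conjOf_qd hD, conjOf_qd hD, qd_neg, neg_neg]

/-- `t · conjOf t ∈ ℚ` and conjugates of nonzero elements are nonzero. [cite: JacobsonWilliams2008, §3.1 (N(α) ∈ ℚ; 1/α = ᾱ/N(α))] -/
theorem conjOf_ne_zero (hD : ¬ IsSquare D) {t : ℝ} (ht : IsQD D t) (h0 : t ≠ 0) : conjOf D t ≠ 0 := by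
  obtain ⟨r, s, rfl⟩ := ht
  rw [conjOf_qd hD]
  intro h
  have h' : qd D r (-s) = qd D 0 0 := by rw [h]; unfold qd; push_cast; ring
  obtain ⟨hr, hs⟩ := qd_inj hD h'
  apply h0
  have : s = 0 := by simpa using hs
  rw [hr, this]; unfold qd; push_cast; ring

/-- Inverses in `ℚ(√D)`: `1/t = conjOf t / (t conjOf t)`. [cite: JacobsonWilliams2008, §3.1 (1/α = ᾱ/N(α))] -/
theorem IsQD.inv (hD : ¬ IsSquare D) {t : ℝ} (ht : IsQD D t) : IsQD D t⁻¹ := by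
  by_cases h0 : t = 0
  · subst h0; rw [inv_zero]; exact ⟨0, 0, by unfold qd; push_cast; ring⟩
  obtain ⟨r, s, rfl⟩ := ht
  have hN : (r : ℝ) ^ 2 - s ^ 2 * D ≠ 0 := by
    have hc := conjOf_ne_zero hD ⟨r, s, rfl⟩ h0
    rw [conjOf_qd hD] at hc
    have : qd D r s * qd D r (-s) = (r : ℝ) ^ 2 - s ^ 2 * D := by
      rw [qd_mul]; unfold qd; push_cast; ring
    rw [← this]; exact mul_ne_zero h0 hc
  refine ⟨r / (r ^ 2 - s ^ 2 * D), -s / (r ^ 2 - s ^ 2 * D), ?_⟩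
  rw [eq_comm, ← mul_eq_one_iff_eq_inv₀ h0]
  have hN' : ((r ^ 2 - s ^ 2 * D : ℚ) : ℝ) ≠ 0 := by push_cast; exact hN
  unfold qd
  have hs : Real.sqrt (D : ℝ) ^ 2 = D := sqrt_sq
  push_cast
  field_simp
  linear_combination (-(s : ℝ) ^ 2) * hs

/-- Conjugation of an inverse. [cite: JacobsonWilliams2008, §3.1 (conjugate of a quotient)] -/
theorem conjOf_inv (hD : ¬ IsSquare D) {t : ℝ} (ht : IsQD D t) (h0 : t ≠ 0) :
    conjOf D t⁻¹ = (conjOf D t)⁻¹ := by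
  have hti := ht.inv hD
  have h1 : conjOf D (t * t⁻¹) = 1 := by rw [mul_inv_cancel₀ h0]; exact_mod_cast conjOf_intCast hD (D := D) 1
  rw [conjOf_mul hD ht hti] at h1
  exact (eq_inv_of_mul_eq_one_right h1)

/-- A finite product of elements of `ℚ(√D)` is in `ℚ(√D)`. [folklore] -/
theorem IsQD.prod {f : ℕ → ℝ} (hf : ∀ k, IsQD D (f k)) (n : ℕ) : IsQD D (∏ k ∈ Finset.range n, f k) := by
  induction n with
  | zero => simpa using IsQD.intCast (D := D) 1
  | succ n ih => rw [Finset.prod_range_succ]; exact ih.mul (hf n)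

/-- Conjugation of a finite product of elements of `ℚ(√D)`. [folklore] -/
theorem conjOf_prod (hD : ¬ IsSquare D) {f : ℕ → ℝ} (hf : ∀ k, IsQD D (f k)) (n : ℕ) :
    conjOf D (∏ k ∈ Finset.range n, f k) = ∏ k ∈ Finset.range n, conjOf D (f k) := by
  have h1 : conjOf D (1 : ℝ) = 1 := by
    have := conjOf_intCast hD (D := D) 1; push_cast at this; exact this
  induction n with
  | zero => simp [h1]
  | succ n ih =>
    rw [Finset.prod_range_succ, Finset.prod_range_succ, conjOf_mul hD (IsQD.prod hf n) (hf n), ih]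

/-! ### Minima -/

/-- **Minimum of a module** (Jozsa Def. 3): `t > 0` in `M` such that no nonzero `μ ∈ M` has both
`|μ| < t` and `|μ̄| < |t̄|`. [cite: Jozsa2003, §6.1 Def. 3] -/
def IsMinimum (D : ℕ) (M : Set ℝ) (t : ℝ) : Prop :=
  0 < t ∧ t ∈ M ∧ ∀ μ ∈ M, μ ≠ 0 → |μ| < t → |conjOf D t| ≤ |conjOf D μ|

/-- Elements of `J(x)` are in `ℚ(√D)`. [folklore] -/
theorem isQD_of_mem_jmod {x : QuadIrr D} {t : ℝ} (ht : t ∈ jmod x) : IsQD D t := by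
  obtain ⟨m, n, rfl⟩ := mem_jmod_iff.mp ht
  exact (IsQD.intCast m).add ((IsQD.intCast n).mul (isQD_val x))

/-- The conjugate of `m + nφ ∈ J(x)` is `m + nφ̄`. [cite: Jozsa2003, §6.1 (the lattice point (α, ᾱ))] -/
theorem conjOf_intCast_add_mul_val (hD : ¬ IsSquare D) (x : QuadIrr D) (m n : ℤ) :
    conjOf D ((m : ℝ) + n * x.val) = m + n * x.conj := by
  rw [conjOf_add hD (IsQD.intCast m) ((IsQD.intCast n).mul (isQD_val x)), conjOf_intCast hD,
    conjOf_mul hD (IsQD.intCast n) (isQD_val x), conjOf_intCast hD, conjOf_val hD]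

/-- **`1` is a minimum of `J(w)` for a reduced `w`** (`φ > 1`, `−1 < φ̄ < 0`: if `|x + yφ| < 1` and
`|x + yφ̄| < 1` then `xy < 0` and `xy > 0`). [cite: JacobsonWilliams2008, §5.1 Thm. 5.8 (second half)] -/
theorem isMinimum_one_of_isReduced (hD : ¬ IsSquare D) {w : QuadIrr D} (hw : w.IsReduced) :
    IsMinimum D (jmod w : Set ℝ) 1 := by
  refine ⟨one_pos, ?_, ?_⟩
  · have := intCast_add_mul_val_mem_jmod w 1 0; simpa using this
  · intro μ hμ hμ0 hμ1
    obtain ⟨m, n, rfl⟩ := mem_jmod_iff.mp hμ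
    rw [show ((1 : ℝ)) = ((1 : ℤ) : ℝ) by norm_num, conjOf_intCast hD, conjOf_intCast_add_mul_val hD]
    push_cast
    rw [abs_one]
    -- `1` and `φ` generate a lattice in which `1` is a minimum (`InfrastructureLattice.lean`)
    have hne : (m, n) ≠ (0, 0) := by
      intro h
      simp only [Prod.mk.injEq] at h
      obtain ⟨rfl, rfl⟩ := h
      exact hμ0 (by simp)
    exact Infra.one_isMin hw.2.2.1 hw.2.2.2.1 hw.2.2.2.2 hne hμ1

/-- **Minima scale** (Jozsa Prop. 22): if `t` is a minimum of `M` and `κ > 0` lies in `ℚ(√D)`,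
then `κt` is a minimum of `κM`. [cite: Jozsa2003, §6.2 Prop. 22] -/
theorem isMinimum_smul (hD : ¬ IsSquare D) {M : Set ℝ} {t κ : ℝ} (hκ : 0 < κ) (hκQ : IsQD D κ)
    (hM : ∀ μ ∈ M, IsQD D μ) (h : IsMinimum D M t) :
    IsMinimum D {u | ∃ μ ∈ M, u = κ * μ} (κ * t) := by
  obtain ⟨ht, htM, hmin⟩ := h
  refine ⟨mul_pos hκ ht, ⟨t, htM, rfl⟩, ?_⟩
  rintro u ⟨μ, hμ, rfl⟩ hu0 hlt
  have hμ0 : μ ≠ 0 := by rintro rfl; exact hu0 (by simp)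
  have hμt : |μ| < t := by
    rw [abs_mul, abs_of_pos hκ] at hlt
    exact lt_of_mul_lt_mul_left hlt hκ.le
  have := hmin μ hμ hμ0 hμt
  rw [conjOf_mul hD hκQ (hM t htM), conjOf_mul hD hκQ (hM μ hμ), abs_mul, abs_mul]
  exact mul_le_mul_of_nonneg_left this (abs_nonneg _)

end QuadIrr

end Literature.NumberTheory.QuadraticFields

end
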